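import Summits.AtomisticToContinuum.BoseEinsteinCondensation.Theorems.FibreConductance.Negative.NearMinimiserFalse

/-!
# Crux `FibreConductance` — the free value `1/4π²` is the floor of the constant

`fibreConductanceWith_zero_const_ge`: any `C` for which the crux's conclusion holds at `v = 0` (some
`ρ₀ > 0`, `N₀`, window `M > 0`) satisfies `C ≥ 1/4π²` — at the constant state (an exact zero-free
minimiser) the charge is `q = L^{-3} e_n(x₀)` and Thomson duality (`norm_pairing_sq_le`) with the
plane-wave test `η = e_{-n}(x₀)` gives every admissible flow the cost `≥ L²/(4π²|n|₂²)`.  Hence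
`not_fibreConductanceSharp`: no UNIVERSAL constant `c < 1/4π²` (cycle-1 §E, re-derived): the free
fibre resistance `1/k²` is the floor; interactions can only push `C` up.

Crux disprover file for `stmt-AtomisticToContinuum-9480` (route `BECThomsonPrinciple`, crux
`FibreConductance`); part of the chain `Profiles → OneDimAxis → (FibreVocabulary) → SlabState →
TestFunction → NearMinimiserFalse` proving `not_fibreConductanceNearMinimiser`: the exact-minimiser
hypothesis (H1) of the crux cannot be relaxed to `δ`-near-minimality for any `δ > 0`.
All [folklore] (elementary real analysis).
-/

noncomputable section

namespace Summit.AtomisticToContinuum.BoseEinsteinCondensation.Theorems.FibreConductance.Negative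

open MeasureTheory Literature.MathematicalPhysics.QuantumManyBody.BoseGas
open scoped ENNReal NNReal

/-! ### Tightness: at `v = 0` no constant below `1/4π²` works -/

section Tight

open Real
open Summit.AtomisticToContinuum.BoseEinsteinCondensation.Theorems.GaussianDominationCan.Negative

variable {m : ℕ} {L : ℝ} {n : Fin 3 → ℤ}

/-- The factors of the plane-wave test function `η(X) = e_{-n}(x₀)`. [folklore] -/
def waveTestFactors (m : ℕ) (L : ℝ) (n : Fin 3 → ℤ) : Fin (m + 1) → Space → ℂ := fun j =>
  if j = 0 then oneBody L (-n) 0 1 else fun _ => 1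

/-- The plane-wave test function `η(X) = e_{-n}(x₀)` as a product function. [folklore] -/
def waveTest (m : ℕ) (L : ℝ) (n : Fin 3 → ℤ) : Config (m + 1) → ℂ := prodFun (waveTestFactors m L n)

/-- The `0`-th factor is `e_{-n}`. [folklore] -/
theorem waveTestFactors_zero : waveTestFactors m L n 0 = oneBody L (-n) 0 1 := by
  simp [waveTestFactors]

/-- The other factors are `1`. [folklore] -/
theorem waveTestFactors_of_ne {j : Fin (m + 1)} (hj : j ≠ 0) : waveTestFactors m L n j = fun _ => 1 := by
  simp [waveTestFactors, hj]

/-- `e_{-n} = 0 + 1·e_{-n}` evaluated. [folklore] -/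
theorem oneBody_zero_one (L : ℝ) (n : Fin 3 → ℤ) (x : Space) : oneBody L (-n) 0 1 x = cellWave L (-n) x := by
  unfold oneBody; push_cast; ring

/-- Every factor is `C¹`. [folklore] -/
theorem contDiff_waveTestFactors (j : Fin (m + 1)) : ContDiff ℝ 1 (waveTestFactors m L n j) := by
  by_cases hj : j = 0
  · subst hj; rw [waveTestFactors_zero]; exact contDiff_oneBody L (-n) 0 1
  · rw [waveTestFactors_of_ne hj]; exact contDiff_const

/-- Every factor is differentiable. [folklore] -/
theorem differentiable_waveTestFactors (j : Fin (m + 1)) : Differentiable ℝ (waveTestFactors m L n j) :=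
  (contDiff_waveTestFactors j).differentiable one_ne_zero

/-- `η` is `C¹`. [folklore] -/
theorem contDiff_waveTest : ContDiff ℝ 1 (waveTest m L n) := contDiff_prodFun contDiff_waveTestFactors

/-- `η` is `Lℤ³`-periodic in every particle. [folklore] -/
theorem waveTest_periodic (hL : L ≠ 0) (X : Config (m + 1)) (i : Fin (m + 1)) (k : Fin 3) :
    waveTest m L n (X + Pi.single i (EuclideanSpace.single k L)) = waveTest m L n X := by
  refine prodFun_periodic (fun j y k => ?_) X i k
  by_cases hj : j = 0
  · subst hj; rw [waveTestFactors_zero]; exact oneBody_periodic hL 0 1 y k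
  · rw [waveTestFactors_of_ne hj]

/-- The bath part of `η` is `1`. [folklore] -/
theorem prod_erase_waveTestFactors (X : Config (m + 1)) :
    ∏ j ∈ Finset.univ.erase (0 : Fin (m + 1)), waveTestFactors m L n j (X j) = 1 :=
  Finset.prod_eq_one fun j hj => by rw [waveTestFactors_of_ne (Finset.ne_of_mem_erase hj)]

/-- `η(X) = e_{-n}(x₀)`. [folklore] -/
theorem waveTest_apply (X : Config (m + 1)) : waveTest m L n X = cellWave L (-n) (X 0) := by
  rw [waveTest, prodFun_eq_mul_erase _ 0, prod_erase_waveTestFactors, mul_one, waveTestFactors_zero,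
    oneBody_zero_one]

/-- **Dual energy density of the plane-wave test**: `Σₗ |∂_{0,l} e_{-n}(x₀)|² = 4π²|n|²/L²`. [folklore] -/
theorem sum_norm_sq_fderiv_waveTest (hL : 0 < L) (X : Config (m + 1)) :
    ∑ l : Fin 3, ‖fderiv ℝ (waveTest m L n) X (Pi.single 0 (EuclideanSpace.single l (1 : ℝ)))‖ ^ 2 =
      4 * π ^ 2 * nsq n / L ^ 2 := by
  unfold waveTest
  have hn : ∀ l : Fin 3,
      ‖fderiv ℝ (prodFun (waveTestFactors m L n)) X (Pi.single 0 (EuclideanSpace.single l (1 : ℝ)))‖ =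
        2 * π * |(n l : ℝ)| / L := by
    intro l
    rw [fderiv_prodFun differentiable_waveTestFactors X 0, prod_erase_waveTestFactors, one_mul,
      waveTestFactors_zero, fderiv_oneBody_single, norm_mul, norm_mul, norm_waveCoeff (n := -n) hL l,
      norm_cellWave, Complex.norm_real, norm_one, one_mul, mul_one, Pi.neg_apply, Int.cast_neg, abs_neg]
  simp_rw [hn, div_pow, mul_pow, sq_abs]
  unfold nsq
  rw [Finset.mul_sum, Finset.sum_div]
  refine Finset.sum_congr rfl fun l _ => ?_
  ring

/-- `∫_cell c² = c² L³`. [folklore] -/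
theorem integral_cell_const_sq (hL : 0 ≤ L) (c : ℝ) : ∫ _y in cell L, c ^ 2 = c ^ 2 * L ^ 3 := by
  rw [setIntegral_const, volume_real_cell hL, smul_eq_mul, mul_comm]

/-- The constant state is the real product of the constant factor. [folklore] -/
theorem constState_ψ_eq_realProd (hL : 0 < L) {c : ℝ} (hc : c ^ 2 * L ^ 3 = 1) :
    (constState m hL c hc).ψ = realProd m (fun _ => c) := rfl

/-- The bath factor of the constant profile: `∏_{j≠0} c² = (c²)^m`. [folklore] -/
theorem bathProd_const (c : ℝ) (X : Config (m + 1)) : bathProd (fun _ : Space => c) X = (c ^ 2) ^ m := by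
  unfold bathProd
  rw [Finset.prod_const, Finset.card_erase_of_mem (Finset.mem_univ _), Finset.card_univ, Fintype.card_fin,
    Nat.add_sub_cancel]

/-- `∫⁻_{cell^N} r = r · L^{3N}` (`ℝ≥0∞`). [folklore] -/
theorem setLIntegral_cellN_const' (hL : 0 ≤ L) (r : ℝ≥0∞) :
    ∫⁻ _X in cellN (m + 1) L, r = r * ENNReal.ofReal ((L ^ 3) ^ (m + 1)) := by
  rw [setLIntegral_const, volume_cellN, ← ENNReal.ofReal_pow hL, ← ENNReal.ofReal_pow (by positivity)]

/-- `∫_{cell^N} c = L^{3N} c` (complex). [folklore] -/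
theorem setIntegral_cellN_const' (hL : 0 ≤ L) (c : ℂ) :
    ∫ _X in cellN (m + 1) L, c = (((L ^ 3) ^ (m + 1) : ℝ) : ℂ) * c := by
  rw [setIntegral_const, Measure.real, volume_cellN, ← ENNReal.ofReal_pow hL,
    ← ENNReal.ofReal_pow (pow_nonneg hL 3), ENNReal.toReal_ofReal (by positivity), Complex.real_smul]

/-- **TIGHTNESS AT THE FREE GAS.** Any constant `C` for which the crux's conclusion holds at
`v = 0` (for some `ρ₀ > 0`, `N₀`, and a window parameter `M > 0`) satisfies `C ≥ 1/4π²`: at the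
constant state (an exact zero-free minimiser) the charge is `q = L^{-3} e_n(x₀)`, and Thomson
duality with the test function `η = e_{-n}(x₀)` gives every admissible flow the cost
`≥ L²/(4π²|n|₂²)`, i.e. `≥ L²/4π²` at `n = e₀` — the free value `1/k²` is the FLOOR of the
bath-averaged fibre resistance; interactions can only push `C` up. [folklore] -/
theorem fibreConductanceWith_zero_const_ge {ρ₀ C M : ℝ} {N₀ : ℕ} (hM : 0 < M) (hρ : 0 < ρ₀) (hC : 0 ≤ C)
    (h : FibreConductanceWith ρ₀ C N₀ 0 M) : 1 / (4 * π ^ 2) ≤ C := by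
  obtain ⟨m, hmN, hmT⟩ := exists_large N₀ (64 * π ^ 6 / (ρ₀ * M ^ 6))
  obtain ⟨hL, hdens, hwin⟩ := corner hM hρ m hmT
  set L : ℝ := M ^ 2 * ((m + 1 : ℕ) : ℝ) / (4 * π ^ 2) with hLdef
  have hL3 : 0 < L ^ 3 := by positivity
  -- the constant state
  set c : ℝ := (Real.sqrt (L ^ 3))⁻¹ with hcdef
  have hcpos : 0 < c := inv_pos.2 (Real.sqrt_pos.2 hL3)
  have hc2 : c ^ 2 = (L ^ 3)⁻¹ := by rw [hcdef, inv_pow, Real.sq_sqrt hL3.le]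
  have hc : c ^ 2 * L ^ 3 = 1 := by rw [hc2, inv_mul_cancel₀ hL3.ne']
  set Φ := constState m hL c hc with hΦ
  have hE : periodicEnergy 0 Φ = periodicGroundStateEnergy 0 (m + 1) L := by
    rw [periodicEnergy_constState hL hc, periodicGroundStateEnergy_zero m hL]
  have hz : ∀ X, Φ.ψ X ≠ 0 := by
    intro X
    rw [hΦ, constState_ψ_eq_realProd hL hc, ← norm_pos_iff, norm_realProd (fun _ => hcpos)]
    exact Finset.prod_pos fun _ _ => hcpos
  obtain ⟨J, hJ, hcost⟩ := h m hmN L hL hdens e0 e0_ne_zero hwin Φ hE hz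
  rw [norm_e0, one_pow, div_one] at hcost
  -- cost in duality form
  have hnorm1 : ∫ y in cell L, (fun _ : Space => c) y ^ 2 = 1 := by
    show ∫ _y in cell L, c ^ 2 = 1
    rw [integral_cell_const_sq hL.le, hc]
  have hφpos : ∀ y : Space, 0 < (fun _ : Space => c) y := fun _ => hcpos
  have hcost' : ∫⁻ X in cellN (m + 1) L, ENNReal.ofReal ((∑ l : Fin 3, ‖J X l‖ ^ 2) *
      (bathProd (fun _ : Space => c) X / (fun _ : Space => c) (X 0) ^ 2)) ≤ ENNReal.ofReal (C * L ^ 2) := by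
    rw [← fibreCost_realProd hφpos hnorm1]
    exact hcost
  have hw : ∀ X : Config (m + 1), 0 < bathProd (fun _ : Space => c) X / (fun _ : Space => c) (X 0) ^ 2 :=
    fun X => div_pos (bathProd_pos hφpos X) (pow_pos hcpos 2)
  have hwm : Measurable fun X : Config (m + 1) =>
      bathProd (fun _ : Space => c) X / (fun _ : Space => c) (X 0) ^ 2 := by
    simp_rw [bathProd_const]
    exact measurable_const
  -- the dual energy of `η = e_{-e₀}(x₀)`
  set D : ℝ := 4 * π ^ 2 / L ^ 2 * (c ^ 2 / (c ^ 2) ^ m) * (L ^ 3) ^ (m + 1) with hD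
  have hD0 : 0 ≤ D := by positivity
  have hdual : ∫⁻ X in cellN (m + 1) L, ENNReal.ofReal
      ((∑ l : Fin 3, ‖fderiv ℝ (waveTest m L e0) X (Pi.single 0 (EuclideanSpace.single l (1 : ℝ)))‖ ^ 2) /
        (bathProd (fun _ : Space => c) X / (fun _ : Space => c) (X 0) ^ 2)) ≤ ENNReal.ofReal D := by
    simp_rw [sum_norm_sq_fderiv_waveTest hL, nsq_e0, bathProd_const]
    rw [setLIntegral_cellN_const' hL.le, ← ENNReal.ofReal_mul (by positivity), hD]
    apply le_of_eq
    congr 1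
    field_simp
  -- the pairing `∫ q η = L^{-3/2} c L^{3N}`
  have hβ : ∫ y in cell L, wave L e0 y * (((fun _ : Space => c) y : ℝ) : ℂ) = 0 := by
    show ∫ y in cell L, wave L e0 y * (c : ℂ) = 0
    simp_rw [wave_eq_cellWave]
    rw [integral_mul_const, integral_cell_cellWave_eq_zero hL e0_ne_zero, zero_mul]
  have hpair : ∫ X in cellN (m + 1) L, fibreCharge L e0 (realProd m (fun _ : Space => c)) X * waveTest m L e0 X =
      ((Real.sqrt (L ^ 3))⁻¹ : ℂ) * (c : ℂ) * ((((L ^ 3) ^ (m + 1) : ℝ)) : ℂ) := by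
    have hpt : ∀ X : Config (m + 1),
        fibreCharge L e0 (realProd m (fun _ : Space => c)) X * waveTest m L e0 X =
          ((Real.sqrt (L ^ 3))⁻¹ : ℂ) * (c : ℂ) := by
      intro X
      rw [fibreCharge_realProd hφpos hnorm1, hβ, zero_mul, sub_zero, waveTest_apply, wave_eq_cellWave]
      have h1 : cellWave L e0 (X 0) * cellWave L (-e0) (X 0) = 1 := by
        rw [← cellWave_add_index, add_neg_cancel, cellWave_zero]
      calc ((Real.sqrt (L ^ 3))⁻¹ : ℂ) * (cellWave L e0 (X 0) * (((fun _ : Space => c) (X 0) : ℝ) : ℂ)) *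
            cellWave L (-e0) (X 0)
          = ((Real.sqrt (L ^ 3))⁻¹ : ℂ) * (c : ℂ) * (cellWave L e0 (X 0) * cellWave L (-e0) (X 0)) := by ring
        _ = ((Real.sqrt (L ^ 3))⁻¹ : ℂ) * (c : ℂ) := by rw [h1, mul_one]
    simp_rw [hpt]
    rw [setIntegral_cellN_const' hL.le]
    ring
  have key := norm_pairing_sq_le hJ (contDiff_waveTest (n := e0)) (waveTest_periodic hL.ne') hw hwm
    (by positivity) hD0 hcost' hdual
  have hpair' : ∫ X in cellN (m + 1) L, fibreCharge L e0 Φ.ψ X * waveTest m L e0 X =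
      ((Real.sqrt (L ^ 3))⁻¹ : ℂ) * (c : ℂ) * ((((L ^ 3) ^ (m + 1) : ℝ)) : ℂ) := hpair
  rw [hpair'] at key
  -- evaluate both sides
  set V : ℝ := (L ^ 3) ^ (m + 1) with hV
  have hVpos : 0 < V := by positivity
  have hA : ‖((Real.sqrt (L ^ 3))⁻¹ : ℂ) * (c : ℂ) * ((V : ℝ) : ℂ)‖ ^ 2 = c ^ 2 * c ^ 2 * V ^ 2 := by
    rw [norm_mul, norm_mul, norm_inv, Complex.norm_real, Complex.norm_real, Complex.norm_real,
      Real.norm_of_nonneg (Real.sqrt_nonneg _), Real.norm_of_nonneg hcpos.le, Real.norm_of_nonneg hVpos.le,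
      ← hcdef]
    ring
  rw [hA, hD] at key
  -- `c² c² V² ≤ C L² · 4π²/L² · c²/(c²)^m · V`, and `(c²)^m · L³... = V⁻¹ L³`: reduce to `1 ≤ 4π² C`
  have hc2m : (c ^ 2) ^ m * V = L ^ 3 := by
    rw [hc2, hV, inv_pow, pow_succ (L ^ 3) m, ← mul_assoc, inv_mul_cancel₀ (by positivity), one_mul]
  have hc2pos : 0 < c ^ 2 := by positivity
  have hcm : 0 < (c ^ 2) ^ m := by positivity
  have key2 : c ^ 2 * c ^ 2 * V ^ 2 * (c ^ 2) ^ m ≤ C * (4 * π ^ 2) * c ^ 2 * V := by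
    have := mul_le_mul_of_nonneg_right key hcm.le
    have e : C * L ^ 2 * (4 * π ^ 2 / L ^ 2 * (c ^ 2 / (c ^ 2) ^ m) * V) * (c ^ 2) ^ m =
        C * (4 * π ^ 2) * c ^ 2 * V := by
      field_simp
    linarith [this, e.le, e.ge]
  -- substitute `(c²)^m V = L³` and `c² L³ = 1`
  have key3 : c ^ 2 * V * (c ^ 2 * ((c ^ 2) ^ m * V)) ≤ C * (4 * π ^ 2) * (c ^ 2 * V) := by
    nlinarith [key2]
  rw [hc2m, hc, mul_one] at key3
  have hcV : 0 < c ^ 2 * V := by positivity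
  have : 1 ≤ C * (4 * π ^ 2) := le_of_mul_le_mul_right (by linarith [key3]) hcV
  rw [div_le_iff₀ (by positivity)]
  linarith

/-- **The sharp-constant strengthening.** The crux with a UNIVERSAL constant `c < 1/4π²`
(one `c` for all admissible bounded `v` and all `M`, the rest of the quantifiers as in the crux). -/
def FibreConductanceSharp : Prop :=
  ∃ c : ℝ, c < 1 / (4 * π ^ 2) ∧
    ∀ v : ℝ → ℝ≥0∞, IsRepulsiveFiniteRange v → (∃ B : ℝ, ∀ r, v r ≤ ENNReal.ofReal B) →
      ∀ M : ℝ, 0 < M → ∃ ρ₀ : ℝ, 0 < ρ₀ ∧ ∃ N₀ : ℕ, FibreConductanceWith ρ₀ c N₀ v M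

/-- **No universal constant below `1/4π²`** (cycle-1 §E re-derived from the duality tool): the
free gas already needs `C ≥ 1/4π²`. [folklore] -/
theorem not_fibreConductanceSharp : ¬ FibreConductanceSharp := by
  rintro ⟨c, hc, h⟩
  obtain ⟨ρ₀, hρ, N₀, hW⟩ := h 0 isRepulsiveFiniteRange_zero ⟨0, fun r => by simp⟩ 1 one_pos
  by_cases hc0 : 0 ≤ c
  · exact absurd (fibreConductanceWith_zero_const_ge one_pos hρ hc0 hW) (not_le.2 hc)
  · -- a negative constant makes the cost bound `≤ ofReal (negative) = 0`; still `≥ 1/4π²` is violated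
    push Not at hc0
    have hW' : FibreConductanceWith ρ₀ 0 N₀ 0 1 := by
      intro m hm L hL hd n hn hw Φ hE hz
      obtain ⟨J, hJ, hcost⟩ := hW m hm L hL hd n hn hw Φ hE hz
      refine ⟨J, hJ, hcost.trans (ENNReal.ofReal_le_ofReal ?_)⟩
      exact div_le_div_of_nonneg_right (mul_le_mul_of_nonneg_right hc0.le (sq_nonneg _)) (sq_nonneg _)
    have := fibreConductanceWith_zero_const_ge one_pos hρ le_rfl hW'
    have hπ : 0 < 1 / (4 * π ^ 2) := by positivity
    linarith

end Tight

end Summit.AtomisticToContinuum.BoseEinsteinCondensation.Theorems.FibreConductance.Negative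

end
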